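import Summits.HubbardSuperconductivity.HubbardSuperconductivity.Theorems.ThermalWedgeTwTipContinuationEdgeOrderTorusTrig

/-!
# `TwTipContinuation` (stmt-HubbardSuperconductivity-1700), line `isogap-submodular-transport`,
# stub `stub_edgeOrder` — piece 4(ii): the d-wave-weighted Cooper logarithm at a FIXED gap buffer

The BCS trial state with gap parameter `D` needs, uniformly in the side `L`, the regularised
d-wave pair susceptibility of the free torus
`I_L(μ, D) = L⁻² Σ_k ĝ_d(k)² / (2 √((ε_L(k) − μ)² + D² ĝ_d(k)² + D⁴))`
to be LARGE once `D` is small: `I_L(μ, D) ≥ (s⁶/(32768 π²)) · log(s³/(384 D))` for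
`|μ| ≤ 4 − 2s²`, `L` even, `L ≥ 400/s²`, `3DL ≥ 2s` (`cooperLog_dWave_ge`), hence for every target
`M` a gap buffer `D ∈ (0,1]` with `I_L(μ,D) ≥ M` eventually in even `L` (`exists_gap_cooperLog`).
Proof: the bulk-rows harmonic walk of the tree's torus Cooper logarithm
(`exists_cooperRow_crossing`, `cooperRow_walk_bounds` of `TorusCooperSumRowWalk`), on the
`≥ s²L/(32π)` rows of the window `cos k₂ ∈ [x₋, x₋ + s²/8]`, `x₋ = −1 + s²/4 − μ/2` (`μ ≤ 0`), along
which the d-wave factor stays `≥ s²/8` and `√(ξ² + D²ĝ² + D⁴) ≤ 2ξ` beyond the buffer `ξ ≥ 3D`;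
`μ ≥ 0` by the `(π,π)` particle–hole symmetry. Constants are not optimised. Folklore (the Cooper
logarithm; Salmhofer 1999 §4.5.4 for its thermal form).
-/

noncomputable section

namespace Summit.HubbardSuperconductivity.TwTipContinuation.IsogapTransport

open Finset Real
open Literature.MathematicalPhysics.QuantumLattice Literature.Probability.LatticeModels

/-! ### The abstract harmonic walk -/

/-- Reindexed harmonic sum: `Σ_{j₁ ≤ j ≤ R} 1/(j+1) ≥ log(R+2) − log(j₁+1)`. [folklore] -/
theorem log_sub_log_le_sum_Icc {j₁ R : ℕ} (h : j₁ ≤ R + 1) :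
    Real.log (R + 2) - Real.log (j₁ + 1) ≤ ∑ j ∈ Finset.Icc j₁ R, (1 : ℝ) / (j + 1) := by
  have hre : ∑ j ∈ Finset.Icc j₁ R, (1 : ℝ) / (j + 1) = ∑ i ∈ Finset.Ico (j₁ + 1) (R + 2), (1 : ℝ) / i := by
    rw [show Finset.Ico (j₁ + 1) (R + 2) = Finset.Icc (j₁ + 1) (R + 1) by ext; simp; omega,
      ← Finset.image_add_right_Icc, Finset.sum_image (fun a _ b _ h => by simpa using h)]
    push_cast
    rfl
  rw [hre]
  have := log_sub_log_le_sum_Ico_one_div (a := j₁ + 1) (c := R + 2) (by omega) (by omega)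
  push_cast at this
  convert this using 2

/-- **Abstract harmonic walk.** If a nonnegative sequence `h` dominates `κ/(j+1)` along a window
`n₀ + j`, `j₁ ≤ j ≤ R`, inside `[0, L)`, then `κ (log(R+2) − log(j₁+1)) ≤ Σ_{n<L} h(n)`. [folklore] -/
theorem harmonicWalk_le_sum {h : ℕ → ℝ} (hh : ∀ n, 0 ≤ h n) {n₀ j₁ R L : ℕ} {κ : ℝ} (hκ : 0 ≤ κ)
    (hwalk : ∀ j, j₁ ≤ j → j ≤ R → κ / (j + 1) ≤ h (n₀ + j)) (hfit : n₀ + R < L) :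
    κ * (Real.log (R + 2) - Real.log (j₁ + 1)) ≤ ∑ n ∈ Finset.range L, h n := by
  by_cases hj : j₁ ≤ R + 1
  · have hinj : Set.InjOn (fun j => n₀ + j) ↑(Finset.Icc j₁ R) := fun a _ b _ hab => by simpa using hab
    have hsub : (Finset.Icc j₁ R).image (fun j => n₀ + j) ⊆ Finset.range L := by
      intro n hn
      rw [Finset.mem_image] at hn
      obtain ⟨j, hj', rfl⟩ := hn
      rw [Finset.mem_Icc] at hj'
      rw [Finset.mem_range]
      omega
    calc κ * (Real.log (R + 2) - Real.log (j₁ + 1))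
        ≤ κ * ∑ j ∈ Finset.Icc j₁ R, (1 : ℝ) / (j + 1) := mul_le_mul_of_nonneg_left (log_sub_log_le_sum_Icc hj) hκ
      _ = ∑ j ∈ Finset.Icc j₁ R, κ / (j + 1) := by
          rw [Finset.mul_sum]
          exact Finset.sum_congr rfl fun j _ => by rw [mul_one_div]
      _ ≤ ∑ j ∈ Finset.Icc j₁ R, h (n₀ + j) :=
          Finset.sum_le_sum fun j hj' => hwalk j (Finset.mem_Icc.1 hj').1 (Finset.mem_Icc.1 hj').2
      _ = ∑ n ∈ (Finset.Icc j₁ R).image (fun j => n₀ + j), h n := (Finset.sum_image hinj).symm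
      _ ≤ ∑ n ∈ Finset.range L, h n := Finset.sum_le_sum_of_subset_of_nonneg hsub fun n _ _ => hh n
  · push Not at hj
    have hlog : Real.log (R + 2) - Real.log (j₁ + 1) ≤ 0 := by
      have : (R : ℝ) + 2 ≤ j₁ + 1 := by
        have h' : R + 2 ≤ j₁ + 1 := by omega
        exact_mod_cast h'
      linarith [Real.log_le_log (by positivity) this]
    exact (mul_nonpos_of_nonneg_of_nonpos hκ hlog).trans (Finset.sum_nonneg fun n _ => hh n)

/-! ### One window row of the torus -/

/-- `√(ξ² + D²ĝ² + D⁴) ≤ ξ + 3D` for `ξ ≥ 0`, `|ĝ| ≤ 2`, `0 ≤ D ≤ 1`. [folklore] -/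
theorem sqrt_reg_le {ξ g D : ℝ} (hξ : 0 ≤ ξ) (hg : |g| ≤ 2) (hD : 0 ≤ D) (hD1 : D ≤ 1) :
    Real.sqrt (ξ ^ 2 + D ^ 2 * g ^ 2 + D ^ 4) ≤ ξ + 3 * D := by
  rw [Real.sqrt_le_left (by positivity)]
  have hg2 : g ^ 2 ≤ 4 := by nlinarith [abs_nonneg g, sq_abs g]
  have h1 : D ^ 2 * g ^ 2 ≤ 4 * D ^ 2 := by nlinarith [sq_nonneg D]
  have hD2 : D ^ 2 ≤ 1 := by nlinarith
  have h2 : D ^ 4 ≤ D ^ 2 := by nlinarith [sq_nonneg D]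
  nlinarith [mul_nonneg hξ hD]

variable {L : ℕ} [NeZero L]

omit [NeZero L] in
/-- The band energy of the momentum `(a, b)` in coordinates. [folklore] -/
theorem torusBand_vecCons (a b : ZMod L) :
    torusBand L ![a, b] = -2 * Real.cos (2 * π * (a.val : ℝ) / L) - 2 * Real.cos (2 * π * (b.val : ℝ) / L) := by
  simp only [torusBand, latticeMomentum, Fin.sum_univ_two, Matrix.cons_val_zero, Matrix.cons_val_one]
  ring

omit [NeZero L] in
/-- The d-wave factor of the momentum `(a, b)` in coordinates. [folklore] -/
theorem dWaveGap_vecCons (a b : ZMod L) :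
    dWaveGap ![a, b] = Real.cos (2 * π * (a.val : ℝ) / L) - Real.cos (2 * π * (b.val : ℝ) / L) := by
  simp only [dWaveGap, latticeMomentum, Matrix.cons_val_zero, Matrix.cons_val_one]

omit [NeZero L] in
/-- The regularised d-wave summand is nonnegative. [folklore] -/
theorem dWaveSummand_nonneg (μ D : ℝ) (k : TorusSite 2 L) :
    0 ≤ dWaveGap k ^ 2 / (2 * Real.sqrt ((torusBand L k - μ) ^ 2 + D ^ 2 * dWaveGap k ^ 2 + D ^ 4)) :=
  div_nonneg (sq_nonneg _) (mul_nonneg zero_le_two (Real.sqrt_nonneg _))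

/-- **One window row carries `κ log(s³/(384D))` of the weighted Cooper sum.** For `0 < s ≤ 1`,
`0 < D ≤ 1`, `L ≥ 400/s²`, `3DL ≥ 2s`, `−4 + 2s² ≤ μ` and a row `b` with
`cos(2πb/L) ∈ [x₋, x₋ + s²/8]`, `x₋ = −1 + s²/4 − μ/2`:
`(s⁴/64)(L/(16π))(log(s²L/64) − log(6DL/s)) ≤ Σ_a ĝ_d(a,b)²/(2√((ε(a,b)−μ)² + D²ĝ_d² + D⁴))`. [folklore] -/
theorem windowRow_sum_ge {s μ D : ℝ} (hs : 0 < s) (hs1 : s ≤ 1) (hD : 0 < D) (hD1 : D ≤ 1)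
    (hL : 400 / s ^ 2 ≤ (L : ℝ)) (hDL : 2 * s ≤ 3 * D * L) (hμ1 : -4 + 2 * s ^ 2 ≤ μ)
    (b : ZMod L) (hb1 : -1 + s ^ 2 / 4 - μ / 2 ≤ Real.cos (2 * π * (b.val : ℝ) / L))
    (hb2 : Real.cos (2 * π * (b.val : ℝ) / L) ≤ -1 + s ^ 2 / 4 - μ / 2 + s ^ 2 / 8) :
    s ^ 4 / 64 * ((L : ℝ) / (16 * π)) * (Real.log (s ^ 2 * L / 64) - Real.log (6 * D * L / s)) ≤
      ∑ a : ZMod L, dWaveGap ![a, b] ^ 2 /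
        (2 * Real.sqrt ((torusBand L ![a, b] - μ) ^ 2 + D ^ 2 * dWaveGap ![a, b] ^ 2 + D ^ 4)) := by
  have hπ := Real.pi_pos
  have hπ3 := Real.pi_lt_d2
  have hs2 : 0 < s ^ 2 := by positivity
  have hsL : 400 ≤ s ^ 2 * L := by rwa [div_le_iff₀ hs2, mul_comm] at hL
  have hLr : (0 : ℝ) < L := by nlinarith
  have hLpos : 0 < L := by exact_mod_cast hLr
  have hs21 : s ^ 2 ≤ 1 := by nlinarith
  -- the row offset, walk length, buffer index, summand and harmonic constant
  set x : ℝ := Real.cos (2 * π * (b.val : ℝ) / L) with hx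
  set c : ℝ := -2 * x - μ with hc
  set R : ℕ := ⌊s ^ 2 * L / 64⌋₊ with hR
  set j₁ : ℕ := ⌈3 * D * L / s⌉₊ with hj₁
  set F : ZMod L → ℝ := fun a => dWaveGap ![a, b] ^ 2 /
    (2 * Real.sqrt ((torusBand L ![a, b] - μ) ^ 2 + D ^ 2 * dWaveGap ![a, b] ^ 2 + D ^ 4)) with hF
  set κ : ℝ := s ^ 4 / 64 * ((L : ℝ) / (16 * π)) with hκ
  have hRle : (R : ℝ) ≤ s ^ 2 * L / 64 := Nat.floor_le (by positivity)
  have hRge : s ^ 2 * L / 64 < R + 1 := Nat.lt_floor_add_one _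
  have hj₁ge : 3 * D * L / s ≤ j₁ := Nat.le_ceil _
  have hj₁lt : (j₁ : ℝ) < 3 * D * L / s + 1 := Nat.ceil_lt_add_one (by positivity)
  clear_value x c R j₁ F κ
  have hc1 : 2 - 3 * s ^ 2 / 4 ≤ c := by rw [hc]; linarith
  have hc2 : c ≤ 2 - s ^ 2 / 2 := by rw [hc]; linarith
  have hcabs : |c| ≤ 2 - s ^ 2 / 2 := by
    rw [abs_le]; constructor <;> nlinarith
  obtain ⟨n₀, -, hn₀L, hg0, hg1, hcos⟩ := exists_cooperRow_crossing hs hs1 hcabs hL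
  have hfit : n₀ + R < L := by
    have h0 : s ^ 2 * (L : ℝ) ≤ L := by nlinarith
    have h1 : (R : ℝ) ≤ L / 64 := hRle.trans (div_le_div_of_nonneg_right h0 (by norm_num))
    have h2 : 2 * (n₀ : ℝ) ≤ L := by exact_mod_cast hn₀L
    have : (n₀ : ℝ) + R < L := by linarith
    exact_mod_cast this
  have hFnn : ∀ a, 0 ≤ F a := fun a => by
    rw [hF]; exact div_nonneg (sq_nonneg _) (mul_nonneg zero_le_two (Real.sqrt_nonneg _))
  have hκ0 : 0 ≤ κ := by rw [hκ]; positivity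
  have hwalk : ∀ j, j₁ ≤ j → j ≤ R → κ / (j + 1) ≤ F ((n₀ + j : ℕ) : ZMod L) := by
    intro j hj1 hj2
    obtain ⟨hξ1, hξ2⟩ := cooperRow_walk_bounds (c := c) hs hs1 hL hn₀L hcos hRle hg0 hg1 hj2
    set ξ : ℝ := -2 * Real.cos (2 * π * ((n₀ + j : ℕ) : ℝ) / L) + c with hξ
    have hnjL : n₀ + j < L := by omega
    have hval : (((n₀ + j : ℕ) : ZMod L)).val = n₀ + j := ZMod.val_cast_of_lt hnjL
    have hband : torusBand L ![((n₀ + j : ℕ) : ZMod L), b] - μ = ξ := by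
      rw [torusBand_vecCons, hval, ← hx, hξ, hc]; ring
    have hgap : dWaveGap ![((n₀ + j : ℕ) : ZMod L), b] = (c - ξ) / 2 - x := by
      rw [dWaveGap_vecCons, hval, ← hx, hξ]; ring
    -- `ξ ≥ 3D` and `ξ ≤ 4π(j+1)/L ≤ πs²/16 + 4π/L`
    have hjr : (j₁ : ℝ) ≤ j := by exact_mod_cast hj1
    have hξD : 3 * D ≤ ξ := by
      have h1 : 3 * D ≤ s * j₁ / L := by
        rw [le_div_iff₀ hLr]
        have := mul_le_mul_of_nonneg_left hj₁ge hs.le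
        rw [show s * (3 * D * L / s) = 3 * D * L by field_simp] at this
        linarith
      have h2 : s * j₁ / L ≤ s * j / L := by gcongr
      linarith
    have hξpos : 0 < ξ := by linarith
    have hξup : ξ ≤ π * s ^ 2 / 16 + 4 * π / L := by
      have hjR : (j : ℝ) ≤ R := by exact_mod_cast hj2
      calc ξ ≤ 4 * π * (j + 1) / L := hξ2
        _ ≤ 4 * π * (s ^ 2 * L / 64 + 1) / L := by gcongr; linarith
        _ = π * s ^ 2 / 16 + 4 * π / L := by field_simp; ring
    -- the d-wave factor stays `≥ s²/8`
    have h4L : 4 * π / L ≤ s ^ 2 / 30 := by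
      rw [div_le_iff₀ hLr]; linarith only [hπ3, hsL]
    have hπs : π * s ^ 2 ≤ 3.15 * s ^ 2 := by nlinarith only [hπ3, hs2]
    have hgd : s ^ 2 / 8 ≤ dWaveGap ![((n₀ + j : ℕ) : ZMod L), b] := by
      rw [hgap, hc]
      have e : (-2 * x - μ - ξ) / 2 - x = -2 * x - μ / 2 - ξ / 2 := by ring
      rw [e]
      linarith only [hb2, hμ1, hξup, h4L, hπs, hs2]
    have hgd2 : s ^ 4 / 64 ≤ dWaveGap ![((n₀ + j : ℕ) : ZMod L), b] ^ 2 := by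
      have h0 : 0 ≤ s ^ 2 / 8 := by positivity
      have := pow_le_pow_left₀ h0 hgd 2
      calc s ^ 4 / 64 = (s ^ 2 / 8) ^ 2 := by ring
        _ ≤ _ := this
    -- the regulator is at most `2ξ`
    have hsqrt : Real.sqrt ((torusBand L ![((n₀ + j : ℕ) : ZMod L), b] - μ) ^ 2 +
        D ^ 2 * dWaveGap ![((n₀ + j : ℕ) : ZMod L), b] ^ 2 + D ^ 4) ≤ 2 * ξ := by
      rw [hband]
      exact (sqrt_reg_le hξpos.le (abs_dWaveGap_le _) hD.le hD1).trans (by linarith)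
    have hsqrt_pos : 0 < Real.sqrt ((torusBand L ![((n₀ + j : ℕ) : ZMod L), b] - μ) ^ 2 +
        D ^ 2 * dWaveGap ![((n₀ + j : ℕ) : ZMod L), b] ^ 2 + D ^ 4) := Real.sqrt_pos.2 (by positivity)
    -- assemble `κ/(j+1) ≤ ĝ²/(2√·)`
    rw [hF]
    simp only
    rw [div_le_div_iff₀ (by positivity) (by positivity)]
    have hden : 2 * Real.sqrt ((torusBand L ![((n₀ + j : ℕ) : ZMod L), b] - μ) ^ 2 +
        D ^ 2 * dWaveGap ![((n₀ + j : ℕ) : ZMod L), b] ^ 2 + D ^ 4) ≤ 16 * π * (j + 1) / L := by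
      calc _ ≤ 2 * (2 * ξ) := by linarith
        _ ≤ 2 * (2 * (4 * π * (j + 1) / L)) := by gcongr
        _ = 16 * π * (j + 1) / L := by ring
    calc κ * (2 * Real.sqrt ((torusBand L ![((n₀ + j : ℕ) : ZMod L), b] - μ) ^ 2 +
          D ^ 2 * dWaveGap ![((n₀ + j : ℕ) : ZMod L), b] ^ 2 + D ^ 4))
        ≤ κ * (16 * π * (j + 1) / L) := mul_le_mul_of_nonneg_left hden hκ0
      _ = s ^ 4 / 64 * (j + 1) := by rw [hκ]; field_simp
      _ ≤ dWaveGap ![((n₀ + j : ℕ) : ZMod L), b] ^ 2 * (j + 1) := by gcongr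
  -- harmonic walk along the row
  have hharm := harmonicWalk_le_sum (h := fun n : ℕ => F ((n : ℕ) : ZMod L)) (fun n => hFnn _) hκ0 hwalk hfit
  -- the row sum over `ZMod L` equals the sum over `n < L`
  have hsum : ∑ n ∈ Finset.range L, F ((n : ℕ) : ZMod L) = ∑ a : ZMod L, F a := by
    refine Finset.sum_nbij (fun n : ℕ => (n : ZMod L)) (fun n _ => Finset.mem_univ _) ?_ ?_ (fun _ _ => rfl)
    · intro n hn m hm h
      have hn' : n < L := by simpa using hn
      have hm' : m < L := by simpa using hm
      have := congrArg ZMod.val h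
      rwa [ZMod.val_cast_of_lt hn', ZMod.val_cast_of_lt hm'] at this
    · intro a _
      exact ⟨a.val, by simpa using ZMod.val_lt a, ZMod.natCast_zmod_val a⟩
  -- the logarithms
  have hlog : Real.log (s ^ 2 * L / 64) - Real.log (6 * D * L / s) ≤ Real.log (R + 2) - Real.log (j₁ + 1) := by
    have hA : Real.log (s ^ 2 * L / 64) ≤ Real.log (R + 2) := Real.log_le_log (by positivity) (by linarith)
    have hB : Real.log (j₁ + 1) ≤ Real.log (6 * D * L / s) := by
      refine Real.log_le_log (by positivity) ?_
      have : (2 : ℝ) ≤ 3 * D * L / s := by rw [le_div_iff₀ hs]; linarith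
      have e : 6 * D * L / s = 3 * D * L / s + 3 * D * L / s := by ring
      linarith
    linarith
  calc κ * (Real.log (s ^ 2 * L / 64) - Real.log (6 * D * L / s))
      ≤ κ * (Real.log (R + 2) - Real.log (j₁ + 1)) := mul_le_mul_of_nonneg_left hlog hκ0
    _ ≤ ∑ n ∈ Finset.range L, F ((n : ℕ) : ZMod L) := hharm
    _ = ∑ a : ZMod L, F a := hsum

/-! ### Assembly over the window rows -/

/-- **The weighted Cooper logarithm below half filling** (`−4 + 2s² ≤ μ ≤ 0`):
`(s⁶/(32768π²))(log(s²L/64) − log(6DL/s)) ≤ L⁻² Σ_k ĝ_d(k)²/(2√((ε_L(k)−μ)² + D²ĝ_d(k)² + D⁴))`.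
[folklore] -/
theorem cooperLog_dWave_ge_of_nonpos {s μ D : ℝ} (hs : 0 < s) (hs1 : s ≤ 1) (hD : 0 < D) (hD1 : D ≤ 1)
    (hL : 400 / s ^ 2 ≤ (L : ℝ)) (hDL : 2 * s ≤ 3 * D * L) (hμ1 : -4 + 2 * s ^ 2 ≤ μ) (hμ2 : μ ≤ 0) :
    s ^ 6 / (32768 * π ^ 2) * (Real.log (s ^ 2 * L / 64) - Real.log (6 * D * L / s)) ≤
      ((L : ℝ) ^ 2)⁻¹ * ∑ k : TorusSite 2 L, dWaveGap k ^ 2 /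
        (2 * Real.sqrt ((torusBand L k - μ) ^ 2 + D ^ 2 * dWaveGap k ^ 2 + D ^ 4)) := by
  have hπ := Real.pi_pos
  have hs2 : 0 < s ^ 2 := by positivity
  have hsL : 400 ≤ s ^ 2 * L := by rwa [div_le_iff₀ hs2, mul_comm] at hL
  have hLr : (0 : ℝ) < L := by nlinarith
  have hLpos : 0 < L := by exact_mod_cast hLr
  set Λ : ℝ := Real.log (s ^ 2 * L / 64) - Real.log (6 * D * L / s) with hΛ
  set G : TorusSite 2 L → ℝ := fun k => dWaveGap k ^ 2 /
    (2 * Real.sqrt ((torusBand L k - μ) ^ 2 + D ^ 2 * dWaveGap k ^ 2 + D ^ 4)) with hG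
  have hGnn : ∀ k, 0 ≤ G k := fun k => dWaveSummand_nonneg μ D k
  clear_value Λ G
  rw [le_inv_mul_iff₀ (by positivity)]
  by_cases hΛ0 : Λ < 0
  · have : (L : ℝ) ^ 2 * (s ^ 6 / (32768 * π ^ 2) * Λ) ≤ 0 :=
      mul_nonpos_of_nonneg_of_nonpos (by positivity) (mul_nonpos_of_nonneg_of_nonpos (by positivity) hΛ0.le)
    exact this.trans (Finset.sum_nonneg fun k _ => hGnn k)
  push Not at hΛ0
  -- the window rows
  set xm : ℝ := -1 + s ^ 2 / 4 - μ / 2 with hxm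
  have ha1 : -1 + s ^ 2 / 8 ≤ xm := by rw [hxm]; linarith
  have ha2 : xm + s ^ 2 / 8 ≤ 1 := by rw [hxm]; nlinarith
  set W : Finset ℕ := (Finset.range (L / 2 + 1)).filter fun n : ℕ =>
    xm ≤ Real.cos (2 * π * (n : ℝ) / L) ∧ Real.cos (2 * π * (n : ℝ) / L) ≤ xm + s ^ 2 / 8 with hW
  have hWcard : s ^ 2 * L / (32 * π) ≤ (W.card : ℝ) := card_windowRows_ge hs hs1 hL ha1 ha2
  have hWlt : ∀ n ∈ W, n < L := by
    intro n hn
    rw [hW, Finset.mem_filter, Finset.mem_range] at hn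
    omega
  set WB : Finset (ZMod L) := W.image fun n : ℕ => (n : ZMod L) with hWB
  have hinj : Set.InjOn (fun n : ℕ => (n : ZMod L)) ↑W := by
    intro n hn m hm h
    have := congrArg ZMod.val h
    rwa [ZMod.val_cast_of_lt (hWlt n hn), ZMod.val_cast_of_lt (hWlt m hm)] at this
  have hWBcard : (WB.card : ℝ) = W.card := by rw [hWB, Finset.card_image_of_injOn hinj]
  -- each window row carries `κ Λ`
  have hrow : ∀ b ∈ WB, s ^ 4 / 64 * ((L : ℝ) / (16 * π)) * Λ ≤ ∑ a : ZMod L, G ![a, b] := by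
    intro b hb
    rw [hWB, Finset.mem_image] at hb
    obtain ⟨n, hn, rfl⟩ := hb
    have hn2 := (Finset.mem_filter.1 hn).2
    rw [hΛ, hG]
    apply windowRow_sum_ge hs hs1 hD hD1 hL hDL hμ1
    · rw [ZMod.val_cast_of_lt (hWlt n hn)]; exact hn2.1
    · rw [ZMod.val_cast_of_lt (hWlt n hn)]; linarith [hn2.2]
  -- the chain
  calc (L : ℝ) ^ 2 * (s ^ 6 / (32768 * π ^ 2) * Λ)
      = s ^ 2 * L / (32 * π) * (s ^ 4 / 64 * ((L : ℝ) / (16 * π)) * Λ) := by field_simp; ring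
    _ ≤ (WB.card : ℝ) * (s ^ 4 / 64 * ((L : ℝ) / (16 * π)) * Λ) := by
        rw [hWBcard]; exact mul_le_mul_of_nonneg_right hWcard (by positivity)
    _ = ∑ b ∈ WB, s ^ 4 / 64 * ((L : ℝ) / (16 * π)) * Λ := by rw [Finset.sum_const, nsmul_eq_mul]
    _ ≤ ∑ b ∈ WB, ∑ a : ZMod L, G ![a, b] := Finset.sum_le_sum hrow
    _ ≤ ∑ b : ZMod L, ∑ a : ZMod L, G ![a, b] :=
        Finset.sum_le_sum_of_subset_of_nonneg (Finset.subset_univ _) fun b _ _ =>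
          Finset.sum_nonneg fun a _ => hGnn _
    _ = ∑ k, G k := (sum_torusSite_two_eq G).symm

/-- **The d-wave-weighted Cooper logarithm at a fixed gap buffer**, both signs of `μ` (even `L`,
`(π,π)` particle–hole symmetry): for `|μ| ≤ 4 − 2s²`,
`(s⁶/(32768π²))(log(s²L/64) − log(6DL/s)) ≤ L⁻² Σ_k ĝ_d(k)²/(2√((ε_L(k)−μ)² + D²ĝ_d(k)² + D⁴))`.
[folklore] -/
theorem cooperLog_dWave_ge {s μ D : ℝ} (hs : 0 < s) (hs1 : s ≤ 1) (hD : 0 < D) (hD1 : D ≤ 1)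
    (hL : 400 / s ^ 2 ≤ (L : ℝ)) (hDL : 2 * s ≤ 3 * D * L) (hE : Even L) (hμ : |μ| ≤ 4 - 2 * s ^ 2) :
    s ^ 6 / (32768 * π ^ 2) * (Real.log (s ^ 2 * L / 64) - Real.log (6 * D * L / s)) ≤
      ((L : ℝ) ^ 2)⁻¹ * ∑ k : TorusSite 2 L, dWaveGap k ^ 2 /
        (2 * Real.sqrt ((torusBand L k - μ) ^ 2 + D ^ 2 * dWaveGap k ^ 2 + D ^ 4)) := by
  rw [abs_le] at hμ
  rcases le_total μ 0 with h | h
  · exact cooperLog_dWave_ge_of_nonpos hs hs1 hD hD1 hL hDL (by linarith) h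
  · have hsymm := sum_shift_symm hE (fun p q => q / (2 * Real.sqrt (p + D ^ 2 * q + D ^ 4))) μ
    rw [hsymm]
    have h' := cooperLog_dWave_ge_of_nonpos (μ := -μ) hs hs1 hD hD1 hL hDL (by linarith) (by linarith)
    simpa only [sub_neg_eq_add] using h'

/-- **A gap buffer with a prescribed Cooper logarithm (piece 4(ii) of `stub_edgeOrder`).** For
`0 < s ≤ 1` and every target `M` there is `D ∈ (0, 1/100]` such that, eventually in even `L`,
`M ≤ L⁻² Σ_k ĝ_d(k)²/(2√((ε_L(k)−μ)² + D²ĝ_d(k)² + D⁴))` for all `|μ| ≤ 4 − 2s²`. [folklore] -/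
theorem exists_gap_cooperLog {s : ℝ} (hs : 0 < s) (hs1 : s ≤ 1) (M : ℝ) :
    ∃ D : ℝ, 0 < D ∧ D ≤ 1 / 100 ∧ ∃ L₁ : ℕ, ∀ (L : ℕ) [NeZero L], L₁ ≤ L → Even L → ∀ μ : ℝ, |μ| ≤ 4 - 2 * s ^ 2 →
      M ≤ ((L : ℝ) ^ 2)⁻¹ * ∑ k : TorusSite 2 L, dWaveGap k ^ 2 /
        (2 * Real.sqrt ((torusBand L k - μ) ^ 2 + D ^ 2 * dWaveGap k ^ 2 + D ^ 4)) := by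
  have hπ := Real.pi_pos
  set κ : ℝ := s ^ 6 / (32768 * π ^ 2) with hκ
  have hκ0 : 0 < κ := by positivity
  set D : ℝ := s ^ 3 / 384 * Real.exp (-(max (M / κ) 0)) with hD
  have hD0 : 0 < D := by positivity
  have hexp1 : Real.exp (-(max (M / κ) 0)) ≤ 1 := by
    rw [Real.exp_le_one_iff]; exact neg_nonpos.2 (le_max_right _ _)
  have hD100 : D ≤ 1 / 100 := by
    have hs3 : s ^ 3 ≤ 1 := by nlinarith [pow_le_one₀ hs.le hs1 (n := 3)]
    calc D ≤ s ^ 3 / 384 * 1 := by rw [hD]; gcongr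
      _ ≤ 1 / 100 := by nlinarith
  have hD1 : D ≤ 1 := hD100.trans (by norm_num)
  refine ⟨D, hD0, hD100, ⌈max (400 / s ^ 2) (2 * s / (3 * D))⌉₊, fun L _ hL hE μ hμ => ?_⟩
  have hL' : max (400 / s ^ 2) (2 * s / (3 * D)) ≤ (L : ℝ) := Nat.ceil_le.mp hL
  have hL1 : 400 / s ^ 2 ≤ (L : ℝ) := (le_max_left _ _).trans hL'
  have hL2 : 2 * s / (3 * D) ≤ (L : ℝ) := (le_max_right _ _).trans hL'
  have hDL : 2 * s ≤ 3 * D * L := by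
    rw [div_le_iff₀ (by positivity)] at hL2; linarith
  have hs2 : 0 < s ^ 2 := by positivity
  have hsL : 400 ≤ s ^ 2 * L := by rwa [div_le_iff₀ hs2, mul_comm] at hL1
  have hLr : (0 : ℝ) < L := by nlinarith
  have key := cooperLog_dWave_ge hs hs1 hD0 hD1 hL1 hDL hE hμ
  refine le_trans ?_ key
  -- `log(s²L/64) − log(6DL/s) = log(s³/(384 D)) = max(M/κ, 0) ≥ M/κ`
  have hlog : Real.log (s ^ 2 * L / 64) - Real.log (6 * D * L / s) = max (M / κ) 0 := by
    rw [← Real.log_div (by positivity) (by positivity)]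
    have : s ^ 2 * (L : ℝ) / 64 / (6 * D * L / s) = Real.exp (max (M / κ) 0) := by
      rw [hD, Real.exp_neg]
      field_simp
      norm_num
    rw [this, Real.log_exp]
  rw [← hκ, hlog]
  have : M / κ ≤ max (M / κ) 0 := le_max_left _ _
  rw [div_le_iff₀ hκ0] at this
  linarith

/-- **A gap buffer with a prescribed d-wave Cooper logarithm (piece 4(ii) of `stub_edgeOrder`)**,
closed form. [folklore] -/
theorem dWave_cooperLog_exists :
    ∀ (s : ℝ), 0 < s → s ≤ 1 → ∀ (M : ℝ), ∃ D : ℝ, 0 < D ∧ D ≤ 1 / 100 ∧ ∃ L₁ : ℕ, ∀ (L : ℕ) [NeZero L], L₁ ≤ L → Even L → ∀ μ : ℝ, |μ| ≤ 4 - 2 * s ^ 2 → M ≤ ((L : ℝ) ^ 2)⁻¹ * ∑ k : TorusSite 2 L, dWaveGap k ^ 2 / (2 * Real.sqrt ((torusBand L k - μ) ^ 2 + D ^ 2 * dWaveGap k ^ 2 + D ^ 4)) :=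
  fun _ hs hs1 M => exists_gap_cooperLog hs hs1 M

end Summit.HubbardSuperconductivity.TwTipContinuation.IsogapTransport
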